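import Literature.Analysis.ValidatedNumerics.ExpSumEnclosure
import Literature.Analysis.SpecialFunctions.KernelLog
import Mathlib.Analysis.SpecialFunctions.ImproperIntegrals
import Mathlib.Analysis.SpecialFunctions.Gamma.Basic
import Mathlib.Analysis.SpecialFunctions.Gaussian.GaussianIntegral
import Mathlib.MeasureTheory.Integral.IntervalIntegral.FundThmCalculus
import HarnessLib

/-!
# Kernel-checked enclosures of `∫_1^∞ e^{-yv} (log v)³ dv` (the Buhler–Gross–Zagier weights, `r = 3`)

Topic `Literature/Analysis/ValidatedNumerics`: a certificate checker in the style of this directory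
(`ExpSumEnclosure.lean`, `MonotoneQuadrature.lean`), built on the exponential-sum checker `ExpSum` over
the multi-precision interval engine `NumericsMP.MI` and on the kernel logarithm `KernelLog.logIv`.

The object: for `y > 0`, `logCubeIntegral y = ∫_{(1,∞)} e^{-yv} (log v)³ dv` (Cremona 1997, §2.13,
the weight `∫_1^∞ e^{-2πny/√N} (log y)^r dy` of (2.13.1) with `r = 3`; Buhler–Gross–Zagier 1985 §3).
The mathematics is the zeroth-order (monotone) Riemann enclosure: on a cell `[a, b] ⊆ [1, ∞)` the
factor `(log v)³` is bracketed by its endpoint values while `e^{-yv}` is integrated EXACTLY,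
`ℓ³ (e^{-ya} − e^{-yb})/y ≤ ∫_a^b e^{-yv} (log v)³ dv ≤ u³ (e^{-ya} − e^{-yb})/y` for
`0 ≤ ℓ ≤ log a`, `log b ≤ u`; the tail beyond the last grid point `V` is bounded by
`∫_V^∞ e^{-yv}(log v)³ dv ≤ 96 e^{-yV/2}/y⁴` (from `(log v)³ ≤ v³ ≤ 48 y^{-3} e^{yv/2}`).  On a grid
of rational points `k/m` (a list of numerators `k`, common denominator `m`, first point `k = m`, i.e.
`v = 1`) with rational `y = yn/yd` every such bound is a finite exponential sum with rational
coefficients and exponents — the scaled log bounds `ℓ, u` come from `KernelLog.logIv` — so the lower /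
upper Riemann sums are literal `ExpSum.ETerm` lists (`loTerms`, `hiTerms`) whose values the kernel
encloses (`ExpSum.checkLB` / `checkUB`, `decide +kernel`).

* `logCubeIntegral y`; `integrableOn_expNegMul_logCube`, `logCubeIntegral_antitone` (monotone in `y`,
  for passing from a rational `y` to a real one), `logCubeIntegral_nonneg`.
* `loTerms m yn yd G`, `hiTerms m yn yd G` (term lists of a grid `G : List ℕ`), `gridOK m G`.
* Soundness: `le_logCubeIntegral_of_checkLB`, `logCubeIntegral_le_of_checkUB`.

NOT here: any particular grid or value (certificates live with their users, e.g. the `5077a`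
third-derivative certificate); higher-order rules.

## References

* J. E. Cremona, *Algorithms for Modular Elliptic Curves*, 2nd ed. (1997), §2.13 (2.13.1).
  [cite: CremonaAlgorithms1997, §2.13]
* R. E. Moore, *Interval Analysis*, Prentice-Hall 1966, §8.1 (interval integration of monotone
  factors by endpoint values). [folklore]
-/

open Real Set MeasureTheory

namespace Literature.Analysis.ValidatedNumerics.ExpLogCube

open Literature.Analysis.ValidatedNumerics.ExpSum Literature.Analysis.SpecialFunctions.KernelLog
open NumericsMP

/-! ## The integral and its elementary analysis -/

/-- The Buhler–Gross–Zagier weight with `r = 3`: `∫_{(1,∞)} e^{-yv} (log v)³ dv`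
(Cremona (2.13.1): `∫_1^∞ exp(-2πny/√N) (log y)^r dy`, `r = 3`, `y ↔ v`, `2πn/√N ↔ y`).
[cite: CremonaAlgorithms1997, §2.13 (2.13.1)] -/
noncomputable def logCubeIntegral (y : ℝ) : ℝ :=
  ∫ v in Ioi (1 : ℝ), Real.exp (-(y * v)) * Real.log v ^ 3

/-- Pointwise majorant on `v > 1`: `0 ≤ e^{-yv} (log v)³ ≤ (48/y³) e^{-(y/2) v}` (`log v ≤ v`,
`v³ ≤ 3!(2/y)³ e^{yv/2}`, Mathlib `Real.pow_div_factorial_le_exp`). [folklore] -/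
private lemma majorant {y : ℝ} (hy : 0 < y) {v : ℝ} (hv : 1 < v) :
    0 ≤ Real.exp (-(y * v)) * Real.log v ^ 3 ∧
      Real.exp (-(y * v)) * Real.log v ^ 3 ≤ 48 / y ^ 3 * Real.exp (-(y / 2) * v) := by
  have hv0 : 0 < v := by linarith
  have hlog0 : 0 ≤ Real.log v := Real.log_nonneg hv.le
  have hlogv : Real.log v ≤ v := (Real.log_le_sub_one_of_pos hv0).trans (by linarith)
  have hl3 : Real.log v ^ 3 ≤ v ^ 3 := pow_le_pow_left₀ hlog0 hlogv 3
  have hexp : (y * v / 2) ^ 3 / (Nat.factorial 3) ≤ Real.exp (y * v / 2) :=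
    Real.pow_div_factorial_le_exp _ (by positivity) 3
  rw [show (Nat.factorial 3 : ℝ) = 6 by norm_num] at hexp
  have hv3 : v ^ 3 ≤ 48 / y ^ 3 * Real.exp (y * v / 2) := by
    rw [div_mul_eq_mul_div, le_div_iff₀ (by positivity)]
    have : (y * v / 2) ^ 3 = y ^ 3 * v ^ 3 / 8 := by ring
    rw [this] at hexp
    nlinarith [Real.exp_pos (y * v / 2)]
  refine ⟨mul_nonneg (Real.exp_pos _).le (pow_nonneg hlog0 3), ?_⟩
  calc Real.exp (-(y * v)) * Real.log v ^ 3
      ≤ Real.exp (-(y * v)) * v ^ 3 := mul_le_mul_of_nonneg_left hl3 (Real.exp_pos _).le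
    _ ≤ Real.exp (-(y * v)) * (48 / y ^ 3 * Real.exp (y * v / 2)) :=
        mul_le_mul_of_nonneg_left hv3 (Real.exp_pos _).le
    _ = 48 / y ^ 3 * Real.exp (-(y / 2) * v) := by
        rw [show Real.exp (-(y * v)) * (48 / y ^ 3 * Real.exp (y * v / 2)) =
          48 / y ^ 3 * (Real.exp (-(y * v)) * Real.exp (y * v / 2)) by ring, ← Real.exp_add]
        congr 2
        ring

/-- The integrand is continuous on `(c, ∞)` for `c ≥ 0`. [folklore] -/
private lemma continuousOn_integrand (y : ℝ) {c : ℝ} (hc : 0 ≤ c) :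
    ContinuousOn (fun v : ℝ ↦ Real.exp (-(y * v)) * Real.log v ^ 3) (Ioi c) :=
  (Continuous.continuousOn (by fun_prop)).mul
    ((Real.continuousOn_log.mono fun v (hv : c < v) ↦ ne_of_gt (hc.trans_lt hv)).pow 3)

/-- **Integrability and the tail bound**: for `y > 0` and `V ≥ 1`, `e^{-yv}(log v)³` is integrable on
`(V, ∞)` and `∫_{(V,∞)} e^{-yv} (log v)³ dv ≤ 96 e^{-yV/2}/y⁴`. [cite: CremonaAlgorithms1997, §2.13 (2.13.1)] -/
theorem integrableOn_and_tail {y : ℝ} (hy : 0 < y) {V : ℝ} (hV : 1 ≤ V) :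
    IntegrableOn (fun v : ℝ ↦ Real.exp (-(y * v)) * Real.log v ^ 3) (Ioi V) ∧
      ∫ v in Ioi V, Real.exp (-(y * v)) * Real.log v ^ 3 ≤
        96 * Real.exp (-(y * V / 2)) / y ^ 4 := by
  have hb : -(y / 2) < 0 := by linarith
  have hm_int : IntegrableOn (fun v : ℝ ↦ 48 / y ^ 3 * Real.exp (-(y / 2) * v)) (Ioi V) :=
    (integrableOn_exp_mul_Ioi hb V).const_mul _
  have hbound : ∀ᵐ v ∂(volume.restrict (Ioi V)),
      ‖Real.exp (-(y * v)) * Real.log v ^ 3‖ ≤ 48 / y ^ 3 * Real.exp (-(y / 2) * v) :=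
    (ae_restrict_iff' measurableSet_Ioi).mpr (Filter.Eventually.of_forall fun v (hv : V < v) ↦ by
      obtain ⟨h0, h1⟩ := majorant hy (lt_of_le_of_lt hV hv)
      rw [Real.norm_of_nonneg h0]
      exact h1)
  have hint : IntegrableOn (fun v : ℝ ↦ Real.exp (-(y * v)) * Real.log v ^ 3) (Ioi V) :=
    Integrable.mono' hm_int
      ((continuousOn_integrand y (zero_le_one.trans hV)).aestronglyMeasurable measurableSet_Ioi)
      hbound
  refine ⟨hint, ?_⟩
  have hle : ∫ v in Ioi V, Real.exp (-(y * v)) * Real.log v ^ 3 ≤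
      ∫ v in Ioi V, 48 / y ^ 3 * Real.exp (-(y / 2) * v) :=
    setIntegral_mono_on hint hm_int measurableSet_Ioi fun v (hv : V < v) ↦
      (majorant hy (lt_of_le_of_lt hV hv)).2
  refine hle.trans (le_of_eq ?_)
  rw [integral_const_mul, integral_exp_mul_Ioi hb V]
  field_simp
  ring_nf

/-- `e^{-yv} (log v)³` is integrable on `(1, ∞)` for `y > 0`. [cite: CremonaAlgorithms1997, §2.13 (2.13.1)] -/
theorem integrableOn_expNegMul_logCube {y : ℝ} (hy : 0 < y) :
    IntegrableOn (fun v : ℝ ↦ Real.exp (-(y * v)) * Real.log v ^ 3) (Ioi 1) :=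
  (integrableOn_and_tail hy le_rfl).1

/-- `0 ≤ ∫_{(c,∞)} e^{-yv}(log v)³ dv` for `c ≥ 1`. [cite: CremonaAlgorithms1997, §2.13 (2.13.1)] -/
theorem setIntegral_Ioi_nonneg {y c : ℝ} (hc : 1 ≤ c) :
    0 ≤ ∫ v in Ioi c, Real.exp (-(y * v)) * Real.log v ^ 3 :=
  setIntegral_nonneg measurableSet_Ioi fun v (hv : c < v) ↦
    mul_nonneg (Real.exp_pos _).le (pow_nonneg (Real.log_nonneg (hc.trans hv.le)) 3)

/-- `0 ≤ logCubeIntegral y`. [cite: CremonaAlgorithms1997, §2.13 (2.13.1)] -/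
theorem logCubeIntegral_nonneg (y : ℝ) : 0 ≤ logCubeIntegral y := setIntegral_Ioi_nonneg le_rfl

/-- **Monotonicity in the rate**: `y ≤ y'`, `0 < y` ⇒ `logCubeIntegral y' ≤ logCubeIntegral y`
(so a real rate may be replaced by rational neighbours). [cite: CremonaAlgorithms1997, §2.13 (2.13.1)] -/
theorem logCubeIntegral_antitone {y y' : ℝ} (hy : 0 < y) (hyy : y ≤ y') :
    logCubeIntegral y' ≤ logCubeIntegral y := by
  unfold logCubeIntegral
  refine setIntegral_mono_on (integrableOn_expNegMul_logCube (hy.trans_le hyy))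
    (integrableOn_expNegMul_logCube hy) measurableSet_Ioi fun v (hv : (1 : ℝ) < v) ↦ ?_
  have hl : 0 ≤ Real.log v ^ 3 := pow_nonneg (Real.log_nonneg hv.le) 3
  refine mul_le_mul_of_nonneg_right (Real.exp_le_exp.mpr ?_) hl
  nlinarith


/-- **The crude bound** `∫_1^∞ e^{-yv}(log v)³ dv ≤ 6 e^{-y}/y⁴` (`log v ≤ v − 1`, then the shifted
Gamma integral `∫_0^∞ e^{-yw} w³ dw = 3!/y⁴`, Mathlib `Real.integral_rpow_mul_exp_neg_mul_Ioi`).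
[cite: CremonaAlgorithms1997, §2.13 (2.13.1)] -/
theorem logCubeIntegral_le_crude {y : ℝ} (hy : 0 < y) :
    logCubeIntegral y ≤ 6 * Real.exp (-y) / y ^ 4 := by
  -- the shifted integrand on `(0, ∞)`
  have hgamma : ∫ w in Ioi (0 : ℝ), w ^ 3 * Real.exp (-(y * w)) = 6 / y ^ 4 := by
    have h := Real.integral_rpow_mul_exp_neg_mul_Ioi (a := 4) (r := y) (by norm_num) hy
    have h4 : Real.Gamma 4 = 6 := by
      rw [show (4 : ℝ) = (3 : ℕ) + 1 by norm_num, Real.Gamma_nat_eq_factorial]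
      norm_num [Nat.factorial]
    rw [h4, show (4 : ℝ) - 1 = (3 : ℕ) by norm_num] at h
    have h' : ∫ w in Ioi (0 : ℝ), w ^ 3 * Real.exp (-(y * w)) =
        ∫ t in Ioi (0 : ℝ), t ^ ((3 : ℕ) : ℝ) * Real.exp (-(y * t)) := by
      refine setIntegral_congr_fun measurableSet_Ioi fun w _ ↦ ?_
      rw [Real.rpow_natCast]
    rw [h', h, show (4 : ℝ) = ((4 : ℕ) : ℝ) by norm_num, Real.rpow_natCast]
    field_simp
  have hgamma' : ∫ w in Ioi (0 : ℝ), w ^ 3 * Real.exp (-(y * w)) = 6 / y ^ 4 := by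
    rw [hgamma]
  -- integrability of the shifted integrand
  have hint0 : IntegrableOn (fun w : ℝ ↦ w ^ 3 * Real.exp (-(y * w))) (Ioi 0) := by
    have h := integrableOn_rpow_mul_exp_neg_mul_rpow (s := 3) (p := 1) (b := y)
      (by norm_num) le_rfl hy
    refine (h.congr_fun (fun w (hw : 0 < w) ↦ ?_) measurableSet_Ioi)
    dsimp only
    rw [Real.rpow_one, show (3 : ℝ) = (3 : ℕ) by norm_num, Real.rpow_natCast, neg_mul]
  -- translate to `(1, ∞)`
  have htrans : ∫ v in Ioi (1 : ℝ), Real.exp (-(y * v)) * (v - 1) ^ 3 =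
      ∫ w in Ioi (0 : ℝ), Real.exp (-(y * (w + 1))) * w ^ 3 := by
    have h := (measurePreserving_add_right volume (1 : ℝ)).setIntegral_preimage_emb
      (measurableEmbedding_addRight 1) (fun v : ℝ ↦ Real.exp (-(y * v)) * (v - 1) ^ 3) (Ioi 1)
    simp only [preimage_add_const_Ioi, sub_self, add_sub_cancel_right] at h
    exact h.symm
  have hint1' : IntegrableOn (fun w : ℝ ↦ Real.exp (-(y * (w + 1))) * w ^ 3) (Ioi 0) := by
    have h2 : (fun w : ℝ ↦ Real.exp (-(y * (w + 1))) * w ^ 3) =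
        fun w : ℝ ↦ Real.exp (-y) * (w ^ 3 * Real.exp (-(y * w))) := by
      funext w
      rw [show -(y * (w + 1)) = -(y * w) + -y by ring, Real.exp_add]
      ring
    rw [h2]
    exact hint0.const_mul _
  have hint1 : IntegrableOn (fun v : ℝ ↦ Real.exp (-(y * v)) * (v - 1) ^ 3) (Ioi 1) := by
    have h := (measurePreserving_add_right volume (1 : ℝ)).integrableOn_comp_preimage
      (measurableEmbedding_addRight 1) (f := fun v : ℝ ↦ Real.exp (-(y * v)) * (v - 1) ^ 3)
      (s := Ioi 1)
    simp only [preimage_add_const_Ioi, sub_self, Function.comp_def, add_sub_cancel_right] at h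
    exact h.mp hint1'
  -- compare pointwise on `(1, ∞)` and evaluate
  calc logCubeIntegral y
      ≤ ∫ v in Ioi (1 : ℝ), Real.exp (-(y * v)) * (v - 1) ^ 3 := by
        refine setIntegral_mono_on (integrableOn_expNegMul_logCube hy) hint1 measurableSet_Ioi
          fun v (hv : (1 : ℝ) < v) ↦ ?_
        have hv0 : 0 < v := zero_lt_one.trans hv
        exact mul_le_mul_of_nonneg_left (pow_le_pow_left₀ (Real.log_nonneg hv.le)
          (Real.log_le_sub_one_of_pos hv0) 3) (Real.exp_pos _).le
    _ = Real.exp (-y) * ∫ w in Ioi (0 : ℝ), w ^ 3 * Real.exp (-(y * w)) := by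
        rw [htrans, ← integral_const_mul]
        refine setIntegral_congr_fun measurableSet_Ioi fun w _ ↦ ?_
        rw [show -(y * (w + 1)) = -(y * w) + -y by ring, Real.exp_add]
        ring
    _ = 6 * Real.exp (-y) / y ^ 4 := by
        rw [hgamma']
        ring

/-- **The exact cell integral of the exponential factor**:
`∫_a^b e^{-yv} dv = (e^{-ya} − e^{-yb})/y` (`y ≠ 0`). [cite: Moore1966, §8.1] -/
theorem integral_cell_exp {y : ℝ} (hy : y ≠ 0) (a b : ℝ) :
    ∫ v in a..b, Real.exp (-(y * v)) = (Real.exp (-(y * a)) - Real.exp (-(y * b))) / y := by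
  have hderiv : ∀ v ∈ uIcc a b,
      HasDerivAt (fun v : ℝ ↦ -Real.exp (-(y * v)) / y) (Real.exp (-(y * v))) v := by
    intro v _
    have h1 : HasDerivAt (fun v : ℝ ↦ -(y * v)) (-y) v := by
      have h := (hasDerivAt_id v).const_mul (-y)
      simp only [id, mul_one] at h
      exact h.congr_of_eventuallyEq (Filter.Eventually.of_forall fun x ↦ by ring)
    have h2 := (h1.exp.neg).div_const y
    have h3 : -(Real.exp (-(y * v)) * -y) / y = Real.exp (-(y * v)) := by
      rw [mul_neg, neg_neg, mul_div_assoc, div_self hy, mul_one]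
    rw [h3] at h2
    exact h2
  rw [intervalIntegral.integral_eq_sub_of_hasDerivAt hderiv
    ((Continuous.continuousOn (by fun_prop)).intervalIntegrable)]
  field_simp
  ring

/-- **One cell, lower**: `0 ≤ ℓ ≤ log a`, `1 ≤ a ≤ b` ⇒
`ℓ³ (e^{-ya} − e^{-yb})/y ≤ ∫_a^b e^{-yv} (log v)³ dv`. [cite: Moore1966, §8.1] -/
theorem cell_lower {y a b ℓ : ℝ} (hy : 0 < y) (ha : 1 ≤ a) (hab : a ≤ b) (hℓ0 : 0 ≤ ℓ)
    (hℓ : ℓ ≤ Real.log a) :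
    ℓ ^ 3 * ((Real.exp (-(y * a)) - Real.exp (-(y * b))) / y) ≤
      ∫ v in a..b, Real.exp (-(y * v)) * Real.log v ^ 3 := by
  rw [← integral_cell_exp hy.ne', ← intervalIntegral.integral_const_mul]
  refine intervalIntegral.integral_mono_on hab
    ((Continuous.continuousOn (by fun_prop)).intervalIntegrable)
    (((continuousOn_integrand y le_rfl).mono fun v (hv : v ∈ Icc a b) ↦
      lt_of_lt_of_le (lt_of_lt_of_le one_pos ha) hv.1).intervalIntegrable_of_Icc hab)
    fun v hv ↦ ?_
  rw [mul_comm]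
  refine mul_le_mul_of_nonneg_left (pow_le_pow_left₀ hℓ0 (hℓ.trans ?_) 3) (Real.exp_pos _).le
  exact Real.log_le_log (lt_of_lt_of_le one_pos ha) hv.1

/-- **One cell, upper**: `log b ≤ u`, `1 ≤ a ≤ b` ⇒
`∫_a^b e^{-yv} (log v)³ dv ≤ u³ (e^{-ya} − e^{-yb})/y`. [cite: Moore1966, §8.1] -/
theorem cell_upper {y a b u : ℝ} (hy : 0 < y) (ha : 1 ≤ a) (hab : a ≤ b) (hu : Real.log b ≤ u) :
    ∫ v in a..b, Real.exp (-(y * v)) * Real.log v ^ 3 ≤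
      u ^ 3 * ((Real.exp (-(y * a)) - Real.exp (-(y * b))) / y) := by
  rw [← integral_cell_exp hy.ne', ← intervalIntegral.integral_const_mul]
  refine intervalIntegral.integral_mono_on hab
    (((continuousOn_integrand y le_rfl).mono fun v (hv : v ∈ Icc a b) ↦
      lt_of_lt_of_le (lt_of_lt_of_le one_pos ha) hv.1).intervalIntegrable_of_Icc hab)
    ((Continuous.continuousOn (by fun_prop)).intervalIntegrable)
    fun v hv ↦ ?_
  rw [mul_comm (u ^ 3)]
  have hv1 : 1 ≤ v := ha.trans hv.1
  refine mul_le_mul_of_nonneg_left (pow_le_pow_left₀ (Real.log_nonneg hv1) ?_ 3)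
    (Real.exp_pos _).le
  exact (Real.log_le_log (lt_of_lt_of_le one_pos hv1) hv.2).trans hu

/-! ## The term lists of a grid and their values -/

/-- Scaled lower log bound `L` with `0 ≤ L/2⁸⁰ ≤ log (k/m)` for `m ≤ k` (`KernelLog.logIv`; `none` if the
kernel logarithm is out of range). [folklore] -/
def logLoZ (k m : ℕ) : Option ℤ :=
  match logIv k, logIv m with
  | some (lo, _), some (_, hi) => some (max 0 (lo - hi))
  | _, _ => none

/-- Scaled upper log bound `U` with `log (k/m) ≤ U/2⁸⁰`. [folklore] -/
def logHiZ (k m : ℕ) : Option ℤ :=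
  match logIv k, logIv m with
  | some (_, hi), some (lo, _) => some (hi - lo)
  | _, _ => none

/-- The lower cell `[k/m, k'/m]` as two exponential terms
`(L/2⁸⁰)³/y · (e^{-yk/m} − e^{-yk'/m})`, `y = yn/yd`; an ill-formed term (denominator `0`, rejected by
every checker) if the kernel logarithm fails. [folklore] -/
def loCell (m yn yd k k' : ℕ) : List ETerm :=
  match logLoZ k m with
  | some L => [⟨L ^ 3 * yd, 2 ^ 240 * yn, -((yn * k : ℕ) : ℤ), yd * m⟩,
      ⟨-(L ^ 3 * yd), 2 ^ 240 * yn, -((yn * k' : ℕ) : ℤ), yd * m⟩]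
  | none => [⟨0, 0, 0, 0⟩]

/-- The upper cell `[k/m, k'/m]`: `(U/2⁸⁰)³/y · (e^{-yk/m} − e^{-yk'/m})` with `U` the scaled upper
bound of `log (k'/m)`. [folklore] -/
def hiCell (m yn yd k k' : ℕ) : List ETerm :=
  match logHiZ k' m with
  | some U => [⟨U ^ 3 * yd, 2 ^ 240 * yn, -((yn * k : ℕ) : ℤ), yd * m⟩,
      ⟨-(U ^ 3 * yd), 2 ^ 240 * yn, -((yn * k' : ℕ) : ℤ), yd * m⟩]
  | none => [⟨0, 0, 0, 0⟩]

/-- The tail term `96 e^{-yV/2}/y⁴`, `V = k/m`, `y = yn/yd`. [folklore] -/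
def tailTerm (m yn yd k : ℕ) : ETerm :=
  ⟨96 * (yd : ℤ) ^ 4, yn ^ 4, -((yn * k : ℕ) : ℤ), 2 * yd * m⟩

/-- Lower Riemann terms of the grid `G = [k₀, k₁, …]` (points `kᵢ/m`). [folklore] -/
def loTerms (m yn yd : ℕ) : List ℕ → List ETerm
  | k :: k' :: rest => loCell m yn yd k k' ++ loTerms m yn yd (k' :: rest)
  | _ => []

/-- Upper Riemann terms of the grid plus the tail beyond its last point. [folklore] -/
def hiTerms (m yn yd : ℕ) : List ℕ → List ETerm
  | [] => []
  | [k] => [tailTerm m yn yd k]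
  | k :: k' :: rest => hiCell m yn yd k k' ++ hiTerms m yn yd (k' :: rest)

/-- Strictly increasing list of numerators (structural Boolean test). [folklore] -/
def incr : List ℕ → Bool
  | k :: k' :: rest => decide (k < k') && incr (k' :: rest)
  | _ => true

/-- Grid sanity: strictly increasing numerators, all `≥ m` (points `≥ 1`). [folklore] -/
def gridOK (m : ℕ) (G : List ℕ) : Bool :=
  incr G && G.all fun k ↦ decide (m ≤ k)

/-- `incr (k :: k' :: rest)` unfolds to `k < k'` and `incr (k' :: rest)`. [cite: Moore1966, Theorem 3.1] -/
theorem incr_cons_cons {k k' : ℕ} {rest : List ℕ} (h : incr (k :: k' :: rest) = true) :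
    k < k' ∧ incr (k' :: rest) = true := by
  simp only [incr, Bool.and_eq_true, decide_eq_true_eq] at h
  exact h

/-- `esum` is additive over concatenation. [cite: Moore1966, Theorem 3.1] -/
theorem esum_append : ∀ L₁ L₂ : List ETerm, esum (L₁ ++ L₂) = esum L₁ + esum L₂
  | [], L₂ => by simp [esum]
  | t :: ts, L₂ => by simp [esum, esum_append ts L₂, add_assoc]

/-- `wf` of a concatenation. [cite: Moore1966, Theorem 3.1] -/
theorem wf_append {L₁ L₂ : List ETerm} (h : wf (L₁ ++ L₂) = true) : wf L₁ = true ∧ wf L₂ = true := by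
  unfold wf at h ⊢
  rw [List.all_append, Bool.and_eq_true] at h
  exact h

/-- The ill-formed singleton is not well formed. [folklore] -/
private lemma wf_poison (L : List ETerm) : wf ((⟨0, 0, 0, 0⟩ : ETerm) :: L) = false := by
  unfold wf
  simp

/-- Soundness of `logLoZ`: `0 ≤ L/2⁸⁰ ≤ log (k/m)` for `0 < m ≤ k`. [cite: Moore1966, Theorem 3.1] -/
theorem logLoZ_sound {k m : ℕ} {L : ℤ} (hm : 0 < m) (hmk : m ≤ k) (h : logLoZ k m = some L) :
    0 ≤ (L : ℝ) / 2 ^ 80 ∧ (L : ℝ) / 2 ^ 80 ≤ Real.log ((k : ℝ) / m) := by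
  unfold logLoZ at h
  split at h
  · rename_i lo hi' lo' hi hk hm'
    simp only [Option.some.injEq] at h
    subst h
    have h1 := (logIv_sound hk).1
    have h2 := (logIv_sound hm').2
    have hk0 : (0 : ℝ) < k := by exact_mod_cast hm.trans_le hmk
    have hm0 : (0 : ℝ) < m := by exact_mod_cast hm
    rw [Real.log_div hk0.ne' hm0.ne']
    refine ⟨by positivity, ?_⟩
    rcases le_total 0 (lo - hi) with hle | hle
    · rw [max_eq_right hle]
      push_cast
      rw [sub_div]
      linarith
    · rw [max_eq_left hle]
      push_cast
      rw [zero_div, sub_nonneg]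
      exact Real.log_le_log hm0 (by exact_mod_cast hmk)
  · simp at h

/-- Soundness of `logHiZ`: `log (k/m) ≤ U/2⁸⁰` for `0 < m`, `0 < k`. [cite: Moore1966, Theorem 3.1] -/
theorem logHiZ_sound {k m : ℕ} {U : ℤ} (hm : 0 < m) (hk : 0 < k) (h : logHiZ k m = some U) :
    Real.log ((k : ℝ) / m) ≤ (U : ℝ) / 2 ^ 80 := by
  unfold logHiZ at h
  split at h
  · rename_i lo' hi lo hi' hk' hm'
    simp only [Option.some.injEq] at h
    subst h
    have h1 := (logIv_sound hk').2
    have h2 := (logIv_sound hm').1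
    have hk0 : (0 : ℝ) < k := by exact_mod_cast hk
    have hm0 : (0 : ℝ) < m := by exact_mod_cast hm
    rw [Real.log_div hk0.ne' hm0.ne']
    push_cast
    rw [sub_div]
    linarith
  · simp at h

/-- Value of the two cell terms: `c/d · e^{-yk/m} − c/d · e^{-yk'/m}` with
`c/d = (Z/2⁸⁰)³/y`. [folklore] -/
private lemma esum_pair {m yn yd k k' : ℕ} (hm : 0 < m) (hyn : 0 < yn) (hyd : 0 < yd) (Z : ℤ) :
    esum [⟨Z ^ 3 * yd, 2 ^ 240 * yn, -((yn * k : ℕ) : ℤ), yd * m⟩,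
        ⟨-(Z ^ 3 * yd), 2 ^ 240 * yn, -((yn * k' : ℕ) : ℤ), yd * m⟩] =
      ((Z : ℝ) / 2 ^ 80) ^ 3 *
        ((Real.exp (-((yn : ℝ) / yd * ((k : ℝ) / m))) -
          Real.exp (-((yn : ℝ) / yd * ((k' : ℝ) / m)))) / ((yn : ℝ) / yd)) := by
  have hm0 : (m : ℝ) ≠ 0 := by exact_mod_cast hm.ne'
  have hyn0 : (yn : ℝ) ≠ 0 := by exact_mod_cast hyn.ne'
  have hyd0 : (yd : ℝ) ≠ 0 := by exact_mod_cast hyd.ne'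
  simp only [esum, ETerm.val]
  push_cast
  have e1 : -((yn : ℝ) * k) / ((yd : ℝ) * m) = -((yn : ℝ) / yd * ((k : ℝ) / m)) := by
    field_simp
  have e2 : -((yn : ℝ) * k') / ((yd : ℝ) * m) = -((yn : ℝ) / yd * ((k' : ℝ) / m)) := by
    field_simp
  rw [e1, e2]
  field_simp
  ring

/-- **Soundness of the lower terms**: for a sane grid whose term list is well formed,
`esum (loTerms G) ≤ ∫_{(k₀/m, ∞)} e^{-yv}(log v)³ dv`, `k₀` the first grid point. [cite: Moore1966, §8.1] -/
theorem esum_loTerms_le {m yn yd : ℕ} (hm : 0 < m) (hyn : 0 < yn) (hyd : 0 < yd) :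
    ∀ (G : List ℕ), incr G = true → (∀ k ∈ G, m ≤ k) → wf (loTerms m yn yd G) = true →
      ∀ k₀ ∈ G.head?, esum (loTerms m yn yd G) ≤
        ∫ v in Ioi ((k₀ : ℝ) / m), Real.exp (-((yn : ℝ) / yd * v)) * Real.log v ^ 3
  | [], _, _, _, k₀, hk₀ => by simp at hk₀
  | [k], _, hGm, _, k₀, hk₀ => by
    simp only [List.head?_cons, Option.mem_def, Option.some.injEq] at hk₀
    subst hk₀
    simp only [loTerms, esum]
    have hk1 : (1 : ℝ) ≤ (k : ℝ) / m := by
      rw [le_div_iff₀ (by exact_mod_cast hm), one_mul]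
      exact_mod_cast hGm k (by simp)
    exact setIntegral_Ioi_nonneg hk1
  | k :: k' :: rest, hG, hGm, hwf, k₀, hk₀ => by
    simp only [List.head?_cons, Option.mem_def, Option.some.injEq] at hk₀
    subst hk₀
    have hy : (0 : ℝ) < (yn : ℝ) / yd := by positivity
    have hmk : m ≤ k := hGm k (by simp)
    have hkk' : k < k' := (incr_cons_cons hG).1
    have hG' : incr (k' :: rest) = true := (incr_cons_cons hG).2
    have hGm' : ∀ j ∈ k' :: rest, m ≤ j := fun j hj ↦ hGm j (List.mem_cons_of_mem _ hj)
    simp only [loTerms] at hwf ⊢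
    obtain ⟨hwf1, hwf2⟩ := wf_append hwf
    have ih := esum_loTerms_le hm hyn hyd (k' :: rest) hG' hGm' hwf2 k' (by simp)
    rw [esum_append]
    -- the cell
    have ha : (1 : ℝ) ≤ (k : ℝ) / m := by
      rw [le_div_iff₀ (by exact_mod_cast hm), one_mul]; exact_mod_cast hmk
    have hab : (k : ℝ) / m ≤ (k' : ℝ) / m :=
      div_le_div_of_nonneg_right (by exact_mod_cast hkk'.le) (by exact_mod_cast hm.le)
    have hint1 : IntegrableOn (fun v : ℝ ↦ Real.exp (-((yn : ℝ) / yd * v)) * Real.log v ^ 3)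
        (Ioi ((k : ℝ) / m)) := (integrableOn_and_tail hy ha).1
    have hint2 : IntegrableOn (fun v : ℝ ↦ Real.exp (-((yn : ℝ) / yd * v)) * Real.log v ^ 3)
        (Ioi ((k' : ℝ) / m)) := (integrableOn_and_tail hy (ha.trans hab)).1
    rw [← intervalIntegral.integral_interval_add_Ioi hint1 hint2]
    refine add_le_add ?_ ih
    unfold loCell at hwf1 ⊢
    split
    · rename_i L hL
      rw [esum_pair hm hyn hyd L]
      obtain ⟨hL0, hL⟩ := logLoZ_sound hm hmk hL
      exact cell_lower hy ha hab hL0 hL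
    · rename_i hnone
      rw [hnone] at hwf1
      simp [wf_poison] at hwf1

/-- **Soundness of the upper terms**: `∫_{(k₀/m, ∞)} e^{-yv}(log v)³ dv ≤ esum (hiTerms G)`.
[cite: Moore1966, §8.1] -/
theorem le_esum_hiTerms {m yn yd : ℕ} (hm : 0 < m) (hyn : 0 < yn) (hyd : 0 < yd) :
    ∀ (G : List ℕ), incr G = true → (∀ k ∈ G, m ≤ k) → wf (hiTerms m yn yd G) = true →
      ∀ k₀ ∈ G.head?,
        ∫ v in Ioi ((k₀ : ℝ) / m), Real.exp (-((yn : ℝ) / yd * v)) * Real.log v ^ 3 ≤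
          esum (hiTerms m yn yd G)
  | [], _, _, _, k₀, hk₀ => by simp at hk₀
  | [k], _, hGm, _, k₀, hk₀ => by
    simp only [List.head?_cons, Option.mem_def, Option.some.injEq] at hk₀
    subst hk₀
    have hy : (0 : ℝ) < (yn : ℝ) / yd := by positivity
    have hk1 : (1 : ℝ) ≤ (k : ℝ) / m := by
      rw [le_div_iff₀ (by exact_mod_cast hm), one_mul]
      exact_mod_cast hGm k (by simp)
    simp only [hiTerms, esum, tailTerm, ETerm.val, add_zero]
    refine (integrableOn_and_tail hy hk1).2.trans (le_of_eq ?_)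
    have hm0 : (m : ℝ) ≠ 0 := by exact_mod_cast hm.ne'
    have hyn0 : (yn : ℝ) ≠ 0 := by exact_mod_cast hyn.ne'
    have hyd0 : (yd : ℝ) ≠ 0 := by exact_mod_cast hyd.ne'
    push_cast
    have e1 : -((yn : ℝ) * k) / (2 * (yd : ℝ) * m) = -((yn : ℝ) / yd * ((k : ℝ) / m) / 2) := by
      field_simp
    rw [e1]
    field_simp
  | k :: k' :: rest, hG, hGm, hwf, k₀, hk₀ => by
    simp only [List.head?_cons, Option.mem_def, Option.some.injEq] at hk₀
    subst hk₀
    have hy : (0 : ℝ) < (yn : ℝ) / yd := by positivity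
    have hmk : m ≤ k := hGm k (by simp)
    have hkk' : k < k' := (incr_cons_cons hG).1
    have hG' : incr (k' :: rest) = true := (incr_cons_cons hG).2
    have hGm' : ∀ j ∈ k' :: rest, m ≤ j := fun j hj ↦ hGm j (List.mem_cons_of_mem _ hj)
    simp only [hiTerms] at hwf ⊢
    obtain ⟨hwf1, hwf2⟩ := wf_append hwf
    have ih := le_esum_hiTerms hm hyn hyd (k' :: rest) hG' hGm' hwf2 k' (by simp)
    rw [esum_append]
    have ha : (1 : ℝ) ≤ (k : ℝ) / m := by
      rw [le_div_iff₀ (by exact_mod_cast hm), one_mul]; exact_mod_cast hmk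
    have hab : (k : ℝ) / m ≤ (k' : ℝ) / m :=
      div_le_div_of_nonneg_right (by exact_mod_cast hkk'.le) (by exact_mod_cast hm.le)
    have hint1 : IntegrableOn (fun v : ℝ ↦ Real.exp (-((yn : ℝ) / yd * v)) * Real.log v ^ 3)
        (Ioi ((k : ℝ) / m)) := (integrableOn_and_tail hy ha).1
    have hint2 : IntegrableOn (fun v : ℝ ↦ Real.exp (-((yn : ℝ) / yd * v)) * Real.log v ^ 3)
        (Ioi ((k' : ℝ) / m)) := (integrableOn_and_tail hy (ha.trans hab)).1
    rw [← intervalIntegral.integral_interval_add_Ioi hint1 hint2]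
    refine add_le_add ?_ ih
    unfold hiCell at hwf1 ⊢
    split
    · rename_i U hU
      rw [esum_pair hm hyn hyd U]
      have hk'0 : 0 < k' := lt_of_le_of_lt (Nat.zero_le _) hkk'
      have hU := logHiZ_sound hm hk'0 hU
      exact cell_upper hy ha hab hU
    · rename_i hnone
      rw [hnone] at hwf1
      simp [wf_poison] at hwf1

/-- `gridOK` unfolds to: strictly increasing and all numerators `≥ m`. [cite: Moore1966, Theorem 3.1] -/
theorem gridOK_spec {m : ℕ} {G : List ℕ} (h : gridOK m G = true) :
    incr G = true ∧ ∀ k ∈ G, m ≤ k := by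
  unfold gridOK at h
  rw [Bool.and_eq_true, List.all_eq_true] at h
  exact ⟨h.1, fun k hk ↦ of_decide_eq_true (h.2 k hk)⟩

/-! ## The kernel certificates -/

/-- From the first grid point (`≥ 1`) to `1`: the integral over `(k₀/m, ∞)` is at most the one over
`(1, ∞)` (nonnegative integrand). [folklore] -/
private lemma setIntegral_Ioi_le_logCubeIntegral {y c : ℝ} (hy : 0 < y) (hc : 1 ≤ c) :
    ∫ v in Ioi c, Real.exp (-(y * v)) * Real.log v ^ 3 ≤ logCubeIntegral y :=
  setIntegral_mono_set (integrableOn_expNegMul_logCube hy)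
    ((ae_restrict_iff' measurableSet_Ioi).mpr (Filter.Eventually.of_forall fun v (hv : 1 < v) ↦
      mul_nonneg (Real.exp_pos _).le (pow_nonneg (Real.log_nonneg hv.le) 3)))
    (Ioi_subset_Ioi hc).eventuallyLE

/-- **Lower bound certificate**: for `y = yn/yd > 0`, a sane grid of points `≥ 1` and
`ExpSum.checkLB S K kk (loTerms m yn yd G) bn bd = true` (kernel), `bn/bd ≤ ∫_1^∞ e^{-yv}(log v)³ dv`.
[cite: Moore1966, §8.1] -/
theorem le_logCubeIntegral_of_checkLB {S K kk m yn yd : ℕ} {G : List ℕ} {bn : ℤ} {bd : ℕ}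
    (hS : 0 < S) (hm : 0 < m) (hyn : 0 < yn) (hyd : 0 < yd) (hbd : 0 < bd)
    (hG : gridOK m G = true) (h : checkLB S K kk (loTerms m yn yd G) bn bd = true) :
    (bn : ℝ) / bd ≤ logCubeIntegral ((yn : ℝ) / yd) := by
  obtain ⟨hG1, hG2⟩ := gridOK_spec hG
  have hle := le_esum_of_checkLB hS hbd h
  have hwf : wf (loTerms m yn yd G) = true := by
    unfold checkLB at h
    exact (Bool.and_eq_true_iff.mp h).1
  cases G with
  | nil =>
    simp only [loTerms, esum] at hle
    exact hle.trans (logCubeIntegral_nonneg _)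
  | cons k₀ rest =>
    have h1 := esum_loTerms_le hm hyn hyd (k₀ :: rest) hG1 hG2 hwf k₀ (by simp)
    have hk1 : (1 : ℝ) ≤ (k₀ : ℝ) / m := by
      rw [le_div_iff₀ (by exact_mod_cast hm), one_mul]
      exact_mod_cast hG2 k₀ (by simp)
    exact hle.trans (h1.trans (setIntegral_Ioi_le_logCubeIntegral (by positivity) hk1))

/-- **Upper bound certificate**: for `y = yn/yd > 0`, a sane grid STARTING AT `m` (the point `1`) and
`ExpSum.checkUB S K kk (hiTerms m yn yd G) bn bd = true` (kernel), `∫_1^∞ e^{-yv}(log v)³ dv ≤ bn/bd`.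
[cite: Moore1966, §8.1] -/
theorem logCubeIntegral_le_of_checkUB {S K kk m yn yd : ℕ} {G : List ℕ} {bn : ℤ} {bd : ℕ}
    (hS : 0 < S) (hm : 0 < m) (hyn : 0 < yn) (hyd : 0 < yd) (hbd : 0 < bd)
    (hG : gridOK m (m :: G) = true) (h : checkUB S K kk (hiTerms m yn yd (m :: G)) bn bd = true) :
    logCubeIntegral ((yn : ℝ) / yd) ≤ (bn : ℝ) / bd := by
  obtain ⟨hG1, hG2⟩ := gridOK_spec hG
  have hle := esum_le_of_checkUB hS hbd h
  have hwf : wf (hiTerms m yn yd (m :: G)) = true := by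
    unfold checkUB at h
    exact (Bool.and_eq_true_iff.mp h).1
  have h1 := le_esum_hiTerms hm hyn hyd (m :: G) hG1 hG2 hwf m (by simp)
  have hm1 : (m : ℝ) / m = 1 := div_self (by exact_mod_cast hm.ne')
  rw [hm1] at h1
  exact h1.trans hle

end Literature.Analysis.ValidatedNumerics.ExpLogCube
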